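import Literature.Computability.Complexity.TVLengthLemmas
import Literature.Computability.Complexity.TVMatrixBricks
import HarnessLib

/-!
# `FP` bricks for Trevisan–Vadhan's oracle machine, IV: the size quantities in unary

Literature / complexity — derandomization (Case 2 of IW98 in TV07 form), fourth machine layer. The
oracle machine for `F` parses everything off the LENGTH of its input (`TVFunction.lean`: `N n`, `Dn n`,
`Mof n`, `blk n`, `ptLen n`, `mlen n`, `slot n`; `TVLengthLemmas.lean`); this file computes those
quantities of a size `t`, given in unary `1ᵗ`, as unary strings (only their LENGTH matters downstream,
and every value lemma is stated on lengths):

* `TVBrick.uN` (`N t = 2t² + 2t`), `TVBrick.uMax` (`max 3 (2t)`), `TVBrick.uDn` (`Dn t`),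
  `TVBrick.uBlk` (`blk t = Mof t + 1`, read as the digit count of the binary numeral of `Dn t + 1`:
  `TM2Pass.length_encodeNat_eq_size`, `QBFUniv.size_Dn_succ`), `TVBrick.uPtLen` (`ptLen t`), `TVBrick.uMlen`
  (`mlen t = t (N t + 1)`), `TVBrick.uSlot` (`slot t`) — each with `_mem_FP` and `length_…` value lemma,
  and the polynomial size bounds `length_u…_le` used by the folds of the next file.

Everything is proved; definitions are `FP` string functions (no named facts).

## References

* [TrevisanVadhan2007] L. Trevisan, S. Vadhan, Comput. Complexity 16 (2007), Thm. 4.3 (proof: the lengths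
  `h(n, i)`), Lemma 4.1 (i).
* [AroraBarakCC2009] S. Arora, B. Barak, CUP 2009, §1.3 (unary/binary conversions, composition).
-/

noncomputable section

namespace Literature.Computability.Complexity

namespace TVBrick

open _root_.Computability Brick Plumb QBFUniv

/-- Unary product of two sub-bricks: `1^{|A w| · |B w|}`. [folklore] -/
def umulB (A B : List Bool → List Bool) : List Bool → List Bool := HashBricks.umulFn ∘ fanoutFn A B

/-- `umulB A B ∈ FP`. [folklore] -/
theorem umulB_mem_FP {A B : List Bool → List Bool} (hA : A ∈ FP) (hB : B ∈ FP) : umulB A B ∈ FP :=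
  comp_mem_FP HashBricks.umulFn_mem_FP (fanoutFn_mem_FP hA hB)

/-- Value of the unary product. [folklore] -/
@[simp] theorem umulB_apply (A B : List Bool → List Bool) (w : List Bool) : umulB A B w = ones ((A w).length * (B w).length) := by
  simp [umulB, HashBricks.umulFn_apply]

/-- Concatenation of two sub-bricks: lengths add. [folklore] -/
def uaddB (A B : List Bool → List Bool) : List Bool → List Bool := appF ∘ fanoutFn A B

/-- `uaddB A B ∈ FP`. [folklore] -/
theorem uaddB_mem_FP {A B : List Bool → List Bool} (hA : A ∈ FP) (hB : B ∈ FP) : uaddB A B ∈ FP :=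
  comp_mem_FP appF_mem_FP (fanoutFn_mem_FP hA hB)

/-- Value of the concatenation. [folklore] -/
@[simp] theorem uaddB_apply (A B : List Bool → List Bool) (w : List Bool) : uaddB A B w = A w ++ B w := by
  simp [uaddB]

/-! ### `N t`, `max 3 (2t)`, `Dn t` -/

/-- **`1^{N t}`** from `1ᵗ`: `2t² + 2t`. [folklore] -/
def uN : List Bool → List Bool :=
  uaddB (uaddB (umulB id id) (umulB id id)) (uaddB id id)

/-- `uN ∈ FP`. [folklore] -/
theorem uN_mem_FP : uN ∈ FP :=
  uaddB_mem_FP (uaddB_mem_FP (umulB_mem_FP (PolyTimeComputable.id _) (PolyTimeComputable.id _))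
    (umulB_mem_FP (PolyTimeComputable.id _) (PolyTimeComputable.id _))) (uaddB_mem_FP (PolyTimeComputable.id _) (PolyTimeComputable.id _))

/-- `|uN u| = N |u|`. [folklore] -/
@[simp] theorem length_uN (u : List Bool) : (uN u).length = N u.length := by
  simp [uN, N_eq, ones]; ring

/-- **`1^{max 3 (2t)}`** from `1ᵗ`. [folklore] -/
def uMax : List Bool → List Bool :=
  iteFn (ltLenF ∘ fanoutFn (uaddB id id) (fun _ => [true, true, true])) (fun _ => [true, true, true]) (uaddB id id)

/-- `uMax ∈ FP`. [folklore] -/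
theorem uMax_mem_FP : uMax ∈ FP :=
  iteFn_mem_FP (comp_mem_FP ltLenF_mem_FP (fanoutFn_mem_FP (uaddB_mem_FP (PolyTimeComputable.id _) (PolyTimeComputable.id _))
    (const_mem_FP _))) (const_mem_FP _) (uaddB_mem_FP (PolyTimeComputable.id _) (PolyTimeComputable.id _))

/-- `|uMax u| = max 3 (2|u|)`. [folklore] -/
@[simp] theorem length_uMax (u : List Bool) : (uMax u).length = max 3 (2 * u.length) := by
  have hc : (ltLenF ∘ fanoutFn (uaddB id id) (fun _ => [true, true, true])) u = [decide (2 * u.length < 3)] := by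
    simp [two_mul]
  rw [uMax, iteFn_apply hc]
  by_cases h : 2 * u.length < 3
  · rw [decide_eq_true h, if_pos rfl]; simp; omega
  · rw [decide_eq_false h]; simp; omega

/-- **`1^{Dn t}`** from `1ᵗ`. [folklore] -/
def uDn : List Bool → List Bool := umulB uN uMax

/-- `uDn ∈ FP`. [folklore] -/
theorem uDn_mem_FP : uDn ∈ FP := umulB_mem_FP uN_mem_FP uMax_mem_FP

/-- `|uDn u| = Dn |u|`. [folklore] -/
@[simp] theorem length_uDn (u : List Bool) : (uDn u).length = Dn u.length := by
  simp [uDn, Dn, ones]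

/-! ### `blk t`, `ptLen t`, `mlen t`, `slot t` -/

/-- **`1^{blk t}`** from `1ᵗ`: the digit count of the binary numeral of `Dn t + 1` (`= Mof t + 1`). [folklore] -/
def uBlk : List Bool → List Bool := onesFn ∘ lenBinF ∘ uaddB (fun _ => [true]) uDn

/-- `uBlk ∈ FP`. [folklore] -/
theorem uBlk_mem_FP : uBlk ∈ FP :=
  comp_mem_FP onesFn_mem_FP (comp_mem_FP lenBinF_mem_FP (uaddB_mem_FP (const_mem_FP _) uDn_mem_FP))

/-- `|uBlk u| = blk |u|`. [folklore] -/
@[simp] theorem length_uBlk (u : List Bool) : (uBlk u).length = blk u.length := by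
  simp only [uBlk, Function.comp_apply, uaddB_apply, lenBinF_apply, List.length_append, List.length_singleton, length_uDn, onesFn,
    unaryEncodeNat_eq_replicate, List.length_replicate, TM2Pass.length_encodeNat_eq_size]
  rw [Nat.add_comm, size_Dn_succ]

/-- **`1^{ptLen t}`** from `1ᵗ`. [folklore] -/
def uPtLen : List Bool → List Bool := umulB uN uBlk

/-- `uPtLen ∈ FP`. [folklore] -/
theorem uPtLen_mem_FP : uPtLen ∈ FP := umulB_mem_FP uN_mem_FP uBlk_mem_FP

/-- `|uPtLen u| = ptLen |u|`. [folklore] -/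
@[simp] theorem length_uPtLen (u : List Bool) : (uPtLen u).length = ptLen u.length := by
  simp [uPtLen, ptLen, ones]

/-- **`1^{mlen t}`** from `1ᵗ`: `t (N t + 1)`. [folklore] -/
def uMlen : List Bool → List Bool := umulB id (uaddB uN (fun _ => [true]))

/-- `uMlen ∈ FP`. [folklore] -/
theorem uMlen_mem_FP : uMlen ∈ FP :=
  umulB_mem_FP (PolyTimeComputable.id _) (uaddB_mem_FP uN_mem_FP (const_mem_FP _))

/-- `|uMlen u| = mlen |u|`. [folklore] -/
@[simp] theorem length_uMlen (u : List Bool) : (uMlen u).length = mlen u.length := by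
  simp [uMlen, mlen, length_uops, ones]

/-- **`1^{slot t}`** from `1ᵗ`. [folklore] -/
def uSlot : List Bool → List Bool := uaddB (uaddB (uaddB uPtLen uBlk) uMlen) (fun _ => [true])

/-- `uSlot ∈ FP`. [folklore] -/
theorem uSlot_mem_FP : uSlot ∈ FP :=
  uaddB_mem_FP (uaddB_mem_FP (uaddB_mem_FP uPtLen_mem_FP uBlk_mem_FP) uMlen_mem_FP) (const_mem_FP _)

/-- `|uSlot u| = slot |u|`. [folklore] -/
@[simp] theorem length_uSlot (u : List Bool) : (uSlot u).length = slot u.length := by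
  simp [uSlot, slot]; omega

/-! ### Polynomial size bounds -/

/-- `N t ≤ 4 t²` for `t ≥ 1`, and in general `N t ≤ 2 t² + 2 t ≤ 4 (t+1)^2`. [folklore] -/
theorem N_le_sq (t : ℕ) : N t ≤ 2 * (t + 1) ^ 2 := by rw [N_eq]; nlinarith

/-- `Dn t ≤ 6 (t+1)³`. [folklore] -/
theorem Dn_le_cube (t : ℕ) : Dn t ≤ 6 * (t + 1) ^ 3 := by
  have h1 := N_le_sq t
  have h2 : max 3 (2 * t) ≤ 3 * (t + 1) := by omega
  calc Dn t = N t * max 3 (2 * t) := rfl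
    _ ≤ 2 * (t + 1) ^ 2 * (3 * (t + 1)) := Nat.mul_le_mul h1 h2
    _ = 6 * (t + 1) ^ 3 := by ring

/-- `blk t ≤ Dn t + 2` (crude: a digit count is at most the number plus one). [folklore] -/
theorem blk_le (t : ℕ) : blk t ≤ Dn t + 2 := by
  have := length_uBlk (ones t)
  simp only [ones, List.length_replicate] at this
  rw [← this, uBlk]
  simp only [Function.comp_apply, uaddB_apply, lenBinF_apply, List.length_append, List.length_singleton, length_uDn,
    List.length_replicate, onesFn, unaryEncodeNat_eq_replicate, TM2Pass.length_encodeNat_eq_size]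
  have := Nat.size_le.2 (Nat.lt_two_pow_self (n := 1 + Dn t))
  calc (1 + Dn t).size ≤ 1 + Dn t := Nat.size_le.2 Nat.lt_two_pow_self
    _ = Dn t + 1 := Nat.add_comm _ _
    _ ≤ Dn t + 2 := Nat.le_succ _

/-- `slot t ≤ 62 (t+1)^6` (every size quantity of `t` is polynomial). [folklore] -/
theorem slot_le (t : ℕ) : slot t ≤ 62 * (t + 1) ^ 6 := by
  have hN := N_le_sq t
  have hD := Dn_le_cube t
  have hb := blk_le t
  have h1 : 1 ≤ (t + 1) ^ 3 := Nat.one_le_pow _ _ (Nat.succ_pos _)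
  have hb' : blk t ≤ 8 * (t + 1) ^ 3 := by nlinarith
  have hp : ptLen t ≤ 16 * (t + 1) ^ 5 := by
    calc ptLen t = N t * blk t := rfl
      _ ≤ 2 * (t + 1) ^ 2 * (8 * (t + 1) ^ 3) := Nat.mul_le_mul hN hb'
      _ = 16 * (t + 1) ^ 5 := by ring
  have hm : mlen t ≤ 6 * (t + 1) ^ 3 := by
    rw [mlen, length_uops]
    calc t * (N t + 1) ≤ (t + 1) * (2 * (t + 1) ^ 2 + 1) := Nat.mul_le_mul (Nat.le_succ _) (by omega)
      _ ≤ (t + 1) * (3 * (t + 1) ^ 2) := Nat.mul_le_mul_left _ (by nlinarith [Nat.one_le_pow 2 (t + 1) (Nat.succ_pos _)])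
      _ = 3 * (t + 1) ^ 3 := by ring
      _ ≤ 6 * (t + 1) ^ 3 := by omega
  have h5 : (t + 1) ^ 5 ≤ (t + 1) ^ 6 := Nat.pow_le_pow_right (Nat.succ_pos _) (by norm_num)
  have h3 : (t + 1) ^ 3 ≤ (t + 1) ^ 6 := Nat.pow_le_pow_right (Nat.succ_pos _) (by norm_num)
  rw [slot]; nlinarith

end TVBrick

end Literature.Computability.Complexity

end
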